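import Summits.NavierStokesRegularity.NavierStokesRegularity.Theorems.OddMorawetzOddMorawetzLocalDSound
import HarnessLib

/-!
# The linearisation of jet polynomials: derivative along a line of jets, and commutation with `D_i`

Calculus over the computable jet algebra of `OddMorawetzLocalJetAlgebra.lean` (crux `OddMorawetzLocal`,
item stmt-NavierStokesRegularity-1376, refutation skeleton, registered stub `lin_analysis`); Mathlib plus the
landed soundness theorem `D_sound` of the total derivative; no definitions, no named facts.

`JPoly.lin p ζ η = Σ_{(c, m) ∈ p} c · prodDeriv m ζ η` is the Leibniz linearisation of the value
`JPoly.evalA p ζ = Σ c · Π_{w ∈ m} ζ w` in the direction `η`.  Three facts transport it to analysis.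

* `hasDerivAt_evalA_line` — `lin p ζ η` is the derivative at `s = 0` of `s ↦ evalA p (ζ + s • η)` (product rule
  along the variable list of each monomial, linearity over the terms).
* `jetVal_add_smul` — the jet coordinates are linear in the field: `jetVal (v + s • b) x = jetVal v x + s • jetVal b x`
  for smooth `v`, `b` (`iteratedFDeriv_add_apply`, `iteratedFDeriv_const_smul_apply`).
* `lin_jetVal_sound` — for smooth fields `v`, `b` the function `y ↦ lin F (jetVal v y) (jetVal b y)` is smooth and
  `∂_i (lin F (jetVal v ·) (jetVal b ·))(x) = lin (D i F) (jetVal v x) (jetVal b x)`: the linearisation commutes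
  with the list-level total derivative `JPoly.D i`.  Direct Leibniz computation: by `D_sound` applied to the
  one-variable polynomial `[(1, [w])]`, each coordinate `y ↦ jetVal u y w` (`u = v` or `b`) is smooth with
  `e_i`-derivative `jetVal u x (w.1, insertIdx i w.2)`, and applied to `[(1, m)]` the plain monomial
  `Π_{w ∈ m} jetVal v y w` has `e_i`-derivative `Σ_{m' ∈ derivVars i m} Π_{w ∈ m'} jetVal v x w`; an induction on
  the monomial `m` with the product rule on `prodDeriv (w :: ws) ζ η = η w · Π ws + ζ w · prodDeriv ws` then
  matches, term by term, the double sum `Σ_{m' ∈ derivVars i m} prodDeriv m' ζ η` (the marked `b`-factor is the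
  differentiated one exactly when the two positions coincide).

The registered conjunction is `lin_analysis`.
-/

noncomputable section

set_option linter.dupNamespace false
set_option autoImplicit false

namespace Summit.NavierStokesRegularity.NavierStokesRegularity.Theorems.OddMorawetz

/-! ### Unfolding lemmas for `evalA`, `lin`, `D` on a cons -/

/-- `evalA` of `t :: p`: the value of the head term plus `evalA p`. -/
private theorem evalA_cons_eq (t : ℝ × List JVar) (p : JPoly ℝ) (ζ : JVar → ℝ) :
    JPoly.evalA (t :: p) ζ = t.1 * (t.2.map ζ).prod + JPoly.evalA p ζ := by
  simp [JPoly.evalA]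

/-- `lin` of `t :: p`: the linearised head term plus `lin p`. -/
private theorem lin_cons_eq (t : ℝ × List JVar) (p : JPoly ℝ) (ζ η : JVar → ℝ) :
    JPoly.lin (t :: p) ζ η = t.1 * JPoly.prodDeriv t.2 ζ η + JPoly.lin p ζ η := by
  simp [JPoly.lin]

/-- `lin (D i (t :: p))`: the linearised derivative of the head monomial plus `lin (D i p)`. -/
private theorem lin_D_cons (i : Fin 3) (t : ℝ × List JVar) (p : JPoly ℝ) (ζ η : JVar → ℝ) :
    JPoly.lin (JPoly.D i (t :: p)) ζ η =
      t.1 * ((JPoly.derivVars i t.2).map fun l => JPoly.prodDeriv l ζ η).sum + JPoly.lin (JPoly.D i p) ζ η := by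
  simp [JPoly.lin, JPoly.D, List.flatMap_cons, List.sum_map_mul_left, Function.comp_def]

/-! ### Part 1: `lin` is the derivative along the line `ζ + s • η` -/

/-- **Product rule along a line**: the monomial `s ↦ Π_{w ∈ m} (ζ + s • η) w` has derivative `prodDeriv m ζ η`
at `s = 0` (induction on `m`). -/
private theorem hasDerivAt_prod_line (ζ η : JVar → ℝ) (m : List JVar) :
    HasDerivAt (fun s : ℝ => (m.map (ζ + s • η)).prod) (JPoly.prodDeriv m ζ η) 0 := by
  induction m with
  | nil => simpa [JPoly.prodDeriv] using hasDerivAt_const (0 : ℝ) (1 : ℝ)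
  | cons w ws ih =>
    have hw : HasDerivAt (fun s : ℝ => (ζ + s • η) w) (η w) 0 := by
      have h := (hasDerivAt_mul_const (η w)).const_add (ζ w) (x := (0 : ℝ))
      simpa [Pi.add_apply, Pi.smul_apply, smul_eq_mul] using h
    have h := hw.fun_mul ih
    simpa [JPoly.prodDeriv] using h

/-- **`lin` is the `s`-derivative along a line of assignments**: for every real jet polynomial `p` and
assignments `ζ`, `η`, the function `s ↦ evalA p (ζ + s • η)` has derivative `lin p ζ η` at `s = 0`. -/
theorem hasDerivAt_evalA_line (p : JPoly ℝ) (ζ η : JVar → ℝ) :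
    HasDerivAt (fun s : ℝ => JPoly.evalA p (ζ + s • η)) (JPoly.lin p ζ η) 0 := by
  induction p with
  | nil => simpa [JPoly.evalA, JPoly.lin] using hasDerivAt_const (0 : ℝ) (0 : ℝ)
  | cons t p ih =>
    have h := ((hasDerivAt_prod_line ζ η t.2).const_mul t.1).fun_add ih
    simpa [evalA_cons_eq, lin_cons_eq] using h

/-! ### Part 2: the jet coordinates are linear in the field -/

/-- **Linearity of the jet coordinates**: `jetVal (v + s • b) x = jetVal v x + s • jetVal b x` for smooth fields
`v`, `b` (additivity and homogeneity of `iteratedFDeriv` for `C^n` maps, evaluated at the argument family and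
the component of each jet variable). -/
theorem jetVal_add_smul (v b : EuclideanSpace ℝ (Fin 3) → EuclideanSpace ℝ (Fin 3))
    (hv : ContDiff ℝ (⊤ : ℕ∞) v) (hb : ContDiff ℝ (⊤ : ℕ∞) b) (s : ℝ) (x : EuclideanSpace ℝ (Fin 3)) :
    jetVal (v + s • b) x = jetVal v x + s • jetVal b x := by
  funext w
  have hvn : ContDiffAt ℝ (w.2.length : ℕ) v x := hv.contDiffAt.of_le (by exact_mod_cast le_top)
  have hbn : ContDiffAt ℝ (w.2.length : ℕ) b x := hb.contDiffAt.of_le (by exact_mod_cast le_top)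
  have hsb : ContDiffAt ℝ (w.2.length : ℕ) (s • b) x := hbn.const_smul s
  simp only [jetVal, Pi.add_apply, Pi.smul_apply, smul_eq_mul]
  rw [iteratedFDeriv_add_apply hvn hsb, iteratedFDeriv_const_smul_apply hbn]
  simp [smul_eq_mul]

/-! ### Part 3: `lin` commutes with the total derivative along jets of smooth fields -/

section

variable {u v b : EuclideanSpace ℝ (Fin 3) → EuclideanSpace ℝ (Fin 3)}

/-- **A jet coordinate is smooth with `∂_i (jetVal u · w) = jetVal u · (w.1, insertIdx i w.2)`**: `D_sound` for
the one-variable polynomial `[(1, [w])]`. -/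
private theorem coord_sound (hu : ContDiff ℝ (⊤ : ℕ∞) u) (w : JVar) :
    ContDiff ℝ (⊤ : ℕ∞) (fun y => jetVal u y w) ∧
      ∀ (i : Fin 3) (x : EuclideanSpace ℝ (Fin 3)),
        fderiv ℝ (fun y => jetVal u y w) x (stdVec i) = jetVal u x (w.1, insertIdx i w.2) := by
  have h := D_sound u hu [(1, [w])]
  simpa [JPoly.evalA, JPoly.D, JPoly.derivVars] using h

/-- **A plain monomial is smooth with `∂_i (Π_{w ∈ m} jetVal u · w) = Σ_{m' ∈ derivVars i m} Π_{w ∈ m'} jetVal u x w`**: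
`D_sound` for the one-term polynomial `[(1, m)]`. -/
private theorem prod_sound (hu : ContDiff ℝ (⊤ : ℕ∞) u) (m : List JVar) :
    ContDiff ℝ (⊤ : ℕ∞) (fun y => (m.map (jetVal u y)).prod) ∧
      ∀ (i : Fin 3) (x : EuclideanSpace ℝ (Fin 3)),
        fderiv ℝ (fun y => (m.map (jetVal u y)).prod) x (stdVec i) =
          ((JPoly.derivVars i m).map fun l => (l.map (jetVal u x)).prod).sum := by
  have h := D_sound u hu [(1, m)]
  simpa [JPoly.evalA, JPoly.D, Function.comp_def] using h

/-- **Leibniz rule for the linearised monomial**: for smooth `v`, `b` the function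
`y ↦ prodDeriv m (jetVal v y) (jetVal b y)` is smooth and its `e_i`-derivative is
`Σ_{m' ∈ derivVars i m} prodDeriv m' (jetVal v x) (jetVal b x)` (induction on `m`; the cons case is the product
rule on `η w · Π ws + ζ w · prodDeriv ws` with `coord_sound` for both fields and `prod_sound` for the plain tail). -/
private theorem prodDeriv_sound (hv : ContDiff ℝ (⊤ : ℕ∞) v) (hb : ContDiff ℝ (⊤ : ℕ∞) b) (m : List JVar) :
    ContDiff ℝ (⊤ : ℕ∞) (fun y => JPoly.prodDeriv m (jetVal v y) (jetVal b y)) ∧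
      ∀ (i : Fin 3) (x : EuclideanSpace ℝ (Fin 3)),
        fderiv ℝ (fun y => JPoly.prodDeriv m (jetVal v y) (jetVal b y)) x (stdVec i) =
          ((JPoly.derivVars i m).map fun l => JPoly.prodDeriv l (jetVal v x) (jetVal b x)).sum := by
  induction m with
  | nil =>
    refine ⟨by simpa [JPoly.prodDeriv] using contDiff_const, fun i x => ?_⟩
    simp [JPoly.prodDeriv, JPoly.derivVars]
  | cons w ws ih =>
    have hbw := coord_sound hb w
    have hvw := coord_sound hv w
    have hws := prod_sound hv ws
    have h1 : ContDiff ℝ (⊤ : ℕ∞) (fun y => jetVal b y w * (ws.map (jetVal v y)).prod) := hbw.1.mul hws.1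
    have h2 : ContDiff ℝ (⊤ : ℕ∞) (fun y => jetVal v y w * JPoly.prodDeriv ws (jetVal v y) (jetVal b y)) :=
      hvw.1.mul ih.1
    simp only [JPoly.prodDeriv]
    refine ⟨h1.add h2, fun i x => ?_⟩
    have d1 : DifferentiableAt ℝ (fun y => jetVal b y w * (ws.map (jetVal v y)).prod) x :=
      (h1.differentiable (by simp)).differentiableAt
    have d2 : DifferentiableAt ℝ (fun y => jetVal v y w * JPoly.prodDeriv ws (jetVal v y) (jetVal b y)) x :=
      (h2.differentiable (by simp)).differentiableAt
    have dbw : DifferentiableAt ℝ (fun y => jetVal b y w) x := (hbw.1.differentiable (by simp)).differentiableAt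
    have dvw : DifferentiableAt ℝ (fun y => jetVal v y w) x := (hvw.1.differentiable (by simp)).differentiableAt
    have dws : DifferentiableAt ℝ (fun y => (ws.map (jetVal v y)).prod) x :=
      (hws.1.differentiable (by simp)).differentiableAt
    have dpd : DifferentiableAt ℝ (fun y => JPoly.prodDeriv ws (jetVal v y) (jetVal b y)) x :=
      (ih.1.differentiable (by simp)).differentiableAt
    rw [fderiv_fun_add d1 d2, add_apply, fderiv_fun_mul dbw dws, fderiv_fun_mul dvw dpd]
    simp only [add_apply, smul_apply, hbw.2 i x, hvw.2 i x, hws.2 i x,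
      ih.2 i x, smul_eq_mul]
    simp only [JPoly.derivVars, List.map_cons, List.sum_cons, List.map_map, Function.comp_def, JPoly.prodDeriv,
      List.sum_map_add, List.sum_map_mul_left]
    ring

end

/-- **`lin` commutes with the total derivative** along jets of smooth fields: for a real jet polynomial `F` and
smooth `v`, `b`, the function `y ↦ lin F (jetVal v y) (jetVal b y)` is smooth and
`∂_i (lin F (jetVal v ·) (jetVal b ·))(x) = lin (D i F) (jetVal v x) (jetVal b x)` (linearity over the terms of
`F` on top of `prodDeriv_sound`). -/
theorem lin_jetVal_sound (F : JPoly ℝ) (v b : EuclideanSpace ℝ (Fin 3) → EuclideanSpace ℝ (Fin 3))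
    (hv : ContDiff ℝ (⊤ : ℕ∞) v) (hb : ContDiff ℝ (⊤ : ℕ∞) b) :
    ContDiff ℝ (⊤ : ℕ∞) (fun y => JPoly.lin F (jetVal v y) (jetVal b y)) ∧
      ∀ (i : Fin 3) (x : EuclideanSpace ℝ (Fin 3)),
        fderiv ℝ (fun y => JPoly.lin F (jetVal v y) (jetVal b y)) x (stdVec i) =
          JPoly.lin (JPoly.D i F) (jetVal v x) (jetVal b x) := by
  induction F with
  | nil =>
    refine ⟨by simpa [JPoly.lin] using contDiff_const, fun i x => ?_⟩
    simp [JPoly.lin, JPoly.D]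
  | cons t p ih =>
    have ht := prodDeriv_sound hv hb t.2
    have hsum : ContDiff ℝ (⊤ : ℕ∞) (fun y =>
        t.1 * JPoly.prodDeriv t.2 (jetVal v y) (jetVal b y) + JPoly.lin p (jetVal v y) (jetVal b y)) :=
      (contDiff_const.mul ht.1).add ih.1
    simp only [lin_cons_eq]
    refine ⟨hsum, fun i x => ?_⟩
    have hd1 : DifferentiableAt ℝ (fun y => t.1 * JPoly.prodDeriv t.2 (jetVal v y) (jetVal b y)) x :=
      ((contDiff_const.mul ht.1).differentiable (by simp)).differentiableAt
    have hd2 : DifferentiableAt ℝ (fun y => JPoly.lin p (jetVal v y) (jetVal b y)) x :=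
      (ih.1.differentiable (by simp)).differentiableAt
    have hd3 : DifferentiableAt ℝ (fun y => JPoly.prodDeriv t.2 (jetVal v y) (jetVal b y)) x :=
      (ht.1.differentiable (by simp)).differentiableAt
    rw [fderiv_fun_add hd1 hd2, add_apply, fderiv_const_mul hd3, smul_apply,
      ht.2 i x, ih.2 i x, lin_D_cons, smul_eq_mul]

/-- **Stub `lin_analysis` of crux `OddMorawetzLocal`** (refutation skeleton).  The linearisation `JPoly.lin` of
the jet algebra is analytically sound: (1) `lin p ζ η` is the derivative at `s = 0` of `s ↦ evalA p (ζ + s • η)`;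
(2) the jet coordinates of smooth fields are linear, `jetVal (v + s • b) x = jetVal v x + s • jetVal b x`;
(3) for smooth `v`, `b` the Euler-derivative integrand `y ↦ lin F (jetVal v y) (jetVal b y)` is smooth and its
partial derivative `∂_i` is `lin (D i F) (jetVal v ·) (jetVal b ·)` — the linearisation commutes with the total
derivative, so the linearisation of a divergence is a divergence. -/
theorem lin_analysis :
    (∀ (p : JPoly ℝ) (ζ η : JVar → ℝ), HasDerivAt (fun s : ℝ => JPoly.evalA p (ζ + s • η)) (JPoly.lin p ζ η) 0) ∧
    (∀ (v b : EuclideanSpace ℝ (Fin 3) → EuclideanSpace ℝ (Fin 3)), ContDiff ℝ (⊤ : ℕ∞) v → ContDiff ℝ (⊤ : ℕ∞) b →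
      ∀ (s : ℝ) (x : EuclideanSpace ℝ (Fin 3)), jetVal (v + s • b) x = jetVal v x + s • jetVal b x) ∧
    (∀ (F : JPoly ℝ) (v b : EuclideanSpace ℝ (Fin 3) → EuclideanSpace ℝ (Fin 3)),
      ContDiff ℝ (⊤ : ℕ∞) v → ContDiff ℝ (⊤ : ℕ∞) b →
        ContDiff ℝ (⊤ : ℕ∞) (fun y => JPoly.lin F (jetVal v y) (jetVal b y)) ∧
        ∀ (i : Fin 3) (x : EuclideanSpace ℝ (Fin 3)),
          fderiv ℝ (fun y => JPoly.lin F (jetVal v y) (jetVal b y)) x (stdVec i) =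
            JPoly.lin (JPoly.D i F) (jetVal v x) (jetVal b x)) :=
  ⟨hasDerivAt_evalA_line, jetVal_add_smul, lin_jetVal_sound⟩

end Summit.NavierStokesRegularity.NavierStokesRegularity.Theorems.OddMorawetz

end
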